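import Summits.QuantumFields.YangMills.Theorems.FradkinShenkerFlowFiniteSusceptibilityWeakCouplingSiblingFunnel
import HarnessLib

/-!
# Mirror-diagonal form of the open stub of crux `FiniteSusceptibilityWeakCoupling` (item stmt-QuantumFields-9442)

Support file for item stmt-QuantumFields-9442 (route `FradkinShenkerFlow` of `YangMills`), line
`sup-axis-reflection-transfer`. The line's single open stub is `C⁺ = AxialCubicMoment`: for compact simple `G`,
faithful unitary `r` and `β ≥ β₀(G, r)`, EVERY PAIR `A, B` of gauge-invariant local observables has time-axis
cubic moments `Σ_{n ≤ S} (n+1)³ |Cov_S(A∘lift, B∘τ_{n e₀}∘lift)|` bounded uniformly in the odd torus `(ℤ/(2S+1))⁴`.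
The landed lever of the line (`stub_mirrorDominationAxis0`, reflection positivity + Cauchy–Schwarz with the mirror
placed midway) states its dominating pairs existentially (`∃ k P Q`), but its proof only ever uses the MIRROR
PAIRS `(A, Aᴿ)`, `(Aᴿ, A)`, `(Bᴿ, B)`, `Aᴿ = A ∘ Θ` (`Θ = cfgReflect`, `t ↦ -t`, temporal links inverted). This file
makes that explicit and draws the consequence:

* `MirrorFunnel.abs_cov_axial_le_mirror` — explicit-pair axial domination: for `β ≥ 0` and `n₀(A,B) ≤ n ≤ S`,
  `|Cov_S(A, τ_{n e₀} B)| ≤ Σ_{j ≤ S, |j - n| ≤ 1} (|Cov_S(A, τ_j Aᴿ)| + |Cov_S(Aᴿ, τ_j A)| + |Cov_S(Bᴿ, τ_j B)|)`;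
* `MirrorFunnel.window_cubic_sum_le` — the one-dimensional window summation with cubic weights;
* `MirrorFunnel.axialMoments_of_mirrorMoments` — at every `β ≥ 0` and for every compact `G`: cubic time-axis moments
  of every species AGAINST ITS OWN MIRROR IMAGE (`Σ_{n ≤ S} (n+1)³ |Cov_S(A∘lift, A∘Θ∘τ_{n e₀}∘lift)| ≤ M(A)`,
  uniformly in `S`) imply the all-pairs cubic moments `C⁺(β)`; the converse is the specialisation `B := Aᴿ`, so the
  two are EQUIVALENT coupling by coupling;
* `finiteSusceptibilityWeakCoupling_of_mirrorCubicMoment` / registered `stub_cruxOfMirrorCubicMoment` — the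
  mirror-diagonal cubic moment bound at all `β ≥ β₀(G, r)` implies the crux (through the landed
  `finiteSusceptibilityWeakCoupling_of_axialCubicMoment`).

So the crux's residual input is a statement about ONE non-negative spectral quantity per local vector (for lags
beyond the support the mirror covariance is `⟨Â, T^{lag} Θ Â⟩ ≥ 0` by reflection positivity): the fourth
resolvent moment of the spectral measure of each gauge-invariant local vector, uniformly in the torus — the form in
which a transfer-matrix / spectral argument would deliver it, and the residual of the sibling line
`mirror-moment-transfer` as well. No engine for it is claimed here (it is the weak-coupling infrared input,
Chatterjee arXiv:1803.01950 Problem 5.1, in cubic-moment form). Everything below holds for every compact `G`;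
no definition is introduced. Mathematics: Osterwalder–Seiler reflection positivity on the odd torus (landed
`stub_oddTorusRP`, `stub_rpCauchySchwarz`) and elementary bookkeeping. [folklore]
-/

noncomputable section

open MeasureTheory ProbabilityTheory Finset
open Literature.MathematicalPhysics.QuantumFieldTheory hiding Site ZdEdge
open Literature.MathematicalPhysics.QuantumLattice
open Literature.Probability.LatticeModels hiding configShift configShift_apply

namespace Summit.QuantumFields.YangMills.Theorems.FiniteSusceptibilityWeakCoupling

namespace MirrorFunnel

open MirrorDominationAxis0

variable {G : Type} [Group G] [TopologicalSpace G] [IsTopologicalGroup G] [CompactSpace G]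
  [MeasurableSpace G] [BorelSpace G]

/-- **Explicit-pair axial mirror domination** (every compact `G`, every `β ≥ 0`). For species `A, B` with time
radius `R₀` of `supp A ∪ supp B`, every lag `n` with `2R₀ + 2 ≤ n ≤ S` satisfies
`|Cov_S(A∘lift, B∘τ_{n e₀}∘lift)| ≤ Σ_{j ≤ S, |j - n| ≤ 1} (|Cov_S(A, τ_j Aᴿ)| + |Cov_S(Aᴿ, τ_j A)| + |Cov_S(Bᴿ, τ_j B)|)`
with `Aᴿ = A ∘ Θ` (`Θ = cfgReflect`). Proof = the proof of the landed `stub_mirrorDominationAxis0` at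
`x = n e₀` with the pairs kept explicit: reflect through the link plane `t = p + ½`, `p = ⌊n/2⌋`; centred RP +
Cauchy–Schwarz (`stub_rpCauchySchwarz stub_oddTorusRP`, plane `(1, p e₀)`) bounds `Cov²` by
`Cov_S(A, τ_{2p+1} Aᴿ) · Cov_S(Bᴿ, τ_{2n-2p-1} B)`, both factors `≥ 0`; a lag `2p + 1 = S + 1` folds to
`Cov_S(Aᴿ, τ_S A)`. [folklore] -/
theorem abs_cov_axial_le_mirror (r : LatticeRep G) {β : ℝ} (hβ : 0 ≤ β) (A B : YMSpecies G) :
    ∃ n₀ : ℕ, ∀ S n : ℕ, n₀ ≤ n → n ≤ S →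
      |cov[fun U => A.F (torusLift (2 * S + 1) U),
          fun U => B.F (configShift (-(Pi.single 0 (n : ℤ))) (torusLift (2 * S + 1) U));
          wilsonMeasure (d := 4) (L := 2 * S + 1) r.ρ β]| ≤
        ∑ j ∈ (range (S + 1)).filter (fun j => n ≤ j + 1 ∧ j ≤ n + 1),
          (|cov[fun U => A.F (torusLift (2 * S + 1) U),
              fun U => A.F (cfgReflect (configShift (-(Pi.single 0 (j : ℤ))) (torusLift (2 * S + 1) U)));
              wilsonMeasure (d := 4) (L := 2 * S + 1) r.ρ β]| +
            |cov[fun U => A.F (cfgReflect (torusLift (2 * S + 1) U)),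
              fun U => A.F (configShift (-(Pi.single 0 (j : ℤ))) (torusLift (2 * S + 1) U));
              wilsonMeasure (d := 4) (L := 2 * S + 1) r.ρ β]| +
            |cov[fun U => B.F (cfgReflect (torusLift (2 * S + 1) U)),
              fun U => B.F (configShift (-(Pi.single 0 (j : ℤ))) (torusLift (2 * S + 1) U));
              wilsonMeasure (d := 4) (L := 2 * S + 1) r.ρ β]|) := by
  -- the time radius `R₀` of the two supports; `n₀ = 2R₀ + 2`
  obtain ⟨R₀, hRA, hRB⟩ : ∃ R₀ : ℕ, (∀ e ∈ A.supp, (e.1 0).natAbs ≤ R₀) ∧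
      ∀ e ∈ B.supp, (e.1 0).natAbs ≤ R₀ := ⟨(A.supp ∪ B.supp).sup fun e => (e.1 0).natAbs,
    fun e he => Finset.le_sup (f := fun e : ZdEdge 4 => (e.1 0).natAbs) (mem_union_left _ he),
    fun e he => Finset.le_sup (f := fun e : ZdEdge 4 => (e.1 0).natAbs) (mem_union_right _ he)⟩
  refine ⟨2 * R₀ + 2, fun S n hn hnS => ?_⟩
  obtain ⟨p, hp⟩ : ∃ p : ℕ, p = n / 2 := ⟨_, rfl⟩
  haveI : IsProbabilityMeasure (wilsonMeasure (d := 4) (L := 2 * S + 1) r.ρ β) :=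
    isProbabilityMeasure_wilsonMeasure _ r.continuous β
  -- RP + Cauchy–Schwarz in the plane `(1, p e₀)` for `F = Aᴿ∘τ_{-(2p+1)e₀}∘lift`, `G' = B∘τ_{-n e₀}∘lift`
  obtain ⟨hD₁, hD₂, hcs⟩ := stub_rpCauchySchwarz stub_oddTorusRP G r.N r.ρ r.continuous β hβ S (by omega) 1
    (Torus.proj (2 * S + 1) (Pi.single 0 (p : ℤ)))
    (fun U => (reflSpecies A).F
      (configShift (-(Pi.single 0 ((2 * p + 1 : ℕ) : ℤ))) (torusLift (2 * S + 1) U)))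
    (fun U => B.F (configShift (-(Pi.single 0 (n : ℤ))) (torusLift (2 * S + 1) U)))
    ((reflSpecies A).measurable.comp ((configShift _).measurable.comp (measurable_torusLift _)))
    (B.measurable.comp ((configShift _).measurable.comp (measurable_torusLift _)))
    (by obtain ⟨C, hC⟩ := (reflSpecies A).bounded; exact ⟨C, fun U => hC _⟩)
    (by obtain ⟨C, hC⟩ := B.bounded; exact ⟨C, fun U => hC _⟩)
    (by
      refine (Negative.dependsOn_comp_configShift_torusLift (2 * S + 1) (reflSpecies A) _).mono ?_
      intro e he
      obtain ⟨e', he', rfl⟩ := Finset.mem_image.1 (Finset.mem_coe.1 he)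
      obtain ⟨e'', he'', rfl⟩ := Finset.mem_image.1 he'
      have ht := hRA e'' he''
      have h0 : ((reflectEdge e'').1 + (Pi.single 0 ((2 * p + 1 : ℕ) : ℤ) : Site 4)) 0 =
          (if e''.2 = 0 then -e''.1 0 - 1 else -e''.1 0) + (2 * p + 1 : ℕ) := by
        rw [Pi.add_apply, reflectEdge_fst_zero, Pi.single_eq_same]
      refine torusEdge_mem_pos S p _ _ ?_ ?_ <;> rw [h0] <;> split_ifs <;> omega)
    (by
      refine (Negative.dependsOn_comp_configShift_torusLift (2 * S + 1) B _).mono ?_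
      intro e he
      obtain ⟨e', he', rfl⟩ := Finset.mem_image.1 (Finset.mem_coe.1 he)
      have ht := hRB e' he'
      have h0 : (e'.1 + (Pi.single 0 (n : ℤ) : Site 4)) 0 = e'.1 0 + n := by
        rw [Pi.add_apply, Pi.single_eq_same]
      refine torusEdge_mem_pos S p _ _ ?_ ?_ <;> rw [h0] <;> omega)
  -- `F∘Θ = A∘lift`, `G'∘Θ = Bᴿ∘τ_{-(θx+(2p+1)e₀)}∘lift`
  simp only [torusLift_theta, reflSpecies_F_shift_cfgReflect_shift] at hD₁ hD₂ hcs
  simp only [F_shift_cfgReflect_shift] at hD₂ hcs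
  have hvec : -(Pi.single 0 (n : ℤ) : Site 4) +
      (siteReflect (Pi.single 0 (n : ℤ) : Site 4) + Pi.single 0 ((2 * p + 1 : ℕ) : ℤ)) =
      -(Pi.single 0 ((2 * n - 2 * p - 1 : ℕ) : ℤ)) := by
    funext k; by_cases hk : k = 0 <;> simp [siteReflect_apply, hk]
    omega
  rw [cov_translate_left r.ρ β (reflSpecies B).F B.F hvec] at hD₂ hcs
  -- bookkeeping of the window `|j - n| ≤ 1`
  set W := (range (S + 1)).filter (fun j => n ≤ j + 1 ∧ j ≤ n + 1) with hW
  set T₀ : ℕ → ℝ := fun j => cov[fun U => A.F (torusLift (2 * S + 1) U),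
      fun U => A.F (cfgReflect (configShift (-(Pi.single 0 (j : ℤ))) (torusLift (2 * S + 1) U)));
      wilsonMeasure (d := 4) (L := 2 * S + 1) r.ρ β] with hT₀
  set T₁ : ℕ → ℝ := fun j => cov[fun U => A.F (cfgReflect (torusLift (2 * S + 1) U)),
      fun U => A.F (configShift (-(Pi.single 0 (j : ℤ))) (torusLift (2 * S + 1) U));
      wilsonMeasure (d := 4) (L := 2 * S + 1) r.ρ β] with hT₁
  set T₂ : ℕ → ℝ := fun j => cov[fun U => B.F (cfgReflect (torusLift (2 * S + 1) U)),
      fun U => B.F (configShift (-(Pi.single 0 (j : ℤ))) (torusLift (2 * S + 1) U));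
      wilsonMeasure (d := 4) (L := 2 * S + 1) r.ρ β] with hT₂
  show _ ≤ ∑ j ∈ W, (|T₀ j| + |T₁ j| + |T₂ j|)
  have hsum : ∀ j : ℕ, j ≤ S → n ≤ j + 1 → j ≤ n + 1 →
      |T₀ j| + |T₁ j| + |T₂ j| ≤ ∑ j ∈ W, (|T₀ j| + |T₁ j| + |T₂ j|) :=
    fun j h1 h2 h3 => Finset.single_le_sum (f := fun j => |T₀ j| + |T₁ j| + |T₂ j|)
      (fun j _ => by positivity) (Finset.mem_filter.2 ⟨Finset.mem_range.2 (by omega), h2, h3⟩)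
  have hle₀ : ∀ j : ℕ, j ≤ S → n ≤ j + 1 → j ≤ n + 1 → T₀ j ≤ ∑ j ∈ W, (|T₀ j| + |T₁ j| + |T₂ j|) :=
    fun j h1 h2 h3 => ((le_abs_self _).trans (by
      have := abs_nonneg (T₁ j); have := abs_nonneg (T₂ j); linarith)).trans (hsum j h1 h2 h3)
  have hle₁ : ∀ j : ℕ, j ≤ S → n ≤ j + 1 → j ≤ n + 1 → T₁ j ≤ ∑ j ∈ W, (|T₀ j| + |T₁ j| + |T₂ j|) :=
    fun j h1 h2 h3 => ((le_abs_self _).trans (by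
      have := abs_nonneg (T₀ j); have := abs_nonneg (T₂ j); linarith)).trans (hsum j h1 h2 h3)
  have hle₂ : ∀ j : ℕ, j ≤ S → n ≤ j + 1 → j ≤ n + 1 → T₂ j ≤ ∑ j ∈ W, (|T₀ j| + |T₁ j| + |T₂ j|) :=
    fun j h1 h2 h3 => ((le_abs_self _).trans (by
      have := abs_nonneg (T₀ j); have := abs_nonneg (T₁ j); linarith)).trans (hsum j h1 h2 h3)
  have h2 : T₂ (2 * n - 2 * p - 1) ≤ _ := hle₂ _ (by omega) (by omega) (by omega)
  by_cases hfold : 2 * p + 1 ≤ S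
  · exact abs_le_of_sq_le_mul hcs hD₁ hD₂ (hle₀ _ hfold (by omega) (by omega)) h2
  · rw [cov_fold r.ρ β A.F (reflSpecies A).F (show 2 * p + 1 ≤ 2 * S + 1 by omega)] at hD₁ hcs
    exact abs_le_of_sq_le_mul hcs hD₁ hD₂ (hle₁ _ (by omega) (by omega) (by omega)) h2

/-- **One-dimensional window summation with cubic weights.** If `|f n| ≤ K` for all `n`, and for
`n₀ ≤ n ≤ S` the value `|f n|` is dominated by the window sum `Σ_{j ≤ S, |j - n| ≤ 1} g j` of a non-negative
sequence, then `Σ_{n ≤ S} (n+1)³ |f n| ≤ (n₀+1)⁴ K + 24 Σ_{j ≤ S} (j+1)³ g j` (small lags: `n₀` terms of size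
`≤ n₀³ K`; large lags: `(n+1)³ ≤ 8 (j+1)³` on the window and every `j` lies in at most three windows). [folklore] -/
theorem window_cubic_sum_le {S n₀ : ℕ} {f g : ℕ → ℝ} {K : ℝ} (hK : ∀ n, |f n| ≤ K) (hg : ∀ j, 0 ≤ g j)
    (hdom : ∀ n, n₀ ≤ n → n ≤ S →
      |f n| ≤ ∑ j ∈ (range (S + 1)).filter (fun j => n ≤ j + 1 ∧ j ≤ n + 1), g j) :
    ∑ n ∈ range (S + 1), ((n : ℝ) + 1) ^ 3 * |f n| ≤
      ((n₀ : ℝ) + 1) ^ 4 * K + 24 * ∑ j ∈ range (S + 1), ((j : ℝ) + 1) ^ 3 * g j := by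
  have hK0 : 0 ≤ K := (abs_nonneg _).trans (hK 0)
  rw [← Finset.sum_filter_add_sum_filter_not (range (S + 1)) (fun n => n < n₀)]
  refine add_le_add ?_ ?_
  · -- small lags
    calc ∑ n ∈ (range (S + 1)).filter (fun n => n < n₀), ((n : ℝ) + 1) ^ 3 * |f n|
        ≤ ∑ n ∈ (range (S + 1)).filter (fun n => n < n₀), ((n₀ : ℝ) + 1) ^ 3 * K := by
          refine Finset.sum_le_sum fun n hn => ?_
          have hn : n < n₀ := (Finset.mem_filter.1 hn).2
          have hn' : (n : ℝ) ≤ n₀ := by exact_mod_cast hn.le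
          have h1 : ((n : ℝ) + 1) ^ 3 ≤ ((n₀ : ℝ) + 1) ^ 3 := by gcongr
          exact mul_le_mul h1 (hK n) (abs_nonneg _) (by positivity)
      _ ≤ ∑ n ∈ range n₀, ((n₀ : ℝ) + 1) ^ 3 * K := by
          refine Finset.sum_le_sum_of_subset_of_nonneg ?_ (fun _ _ _ => by positivity)
          intro n hn
          exact Finset.mem_range.2 (Finset.mem_filter.1 hn).2
      _ = (n₀ : ℝ) * (((n₀ : ℝ) + 1) ^ 3 * K) := by rw [Finset.sum_const, card_range, nsmul_eq_mul]
      _ ≤ ((n₀ : ℝ) + 1) ^ 4 * K := by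
          have h1 : (n₀ : ℝ) ≤ (n₀ : ℝ) + 1 := by linarith
          have h3 : 0 ≤ ((n₀ : ℝ) + 1) ^ 3 * K := by positivity
          calc (n₀ : ℝ) * (((n₀ : ℝ) + 1) ^ 3 * K) ≤ ((n₀ : ℝ) + 1) * (((n₀ : ℝ) + 1) ^ 3 * K) :=
                mul_le_mul_of_nonneg_right h1 h3
            _ = ((n₀ : ℝ) + 1) ^ 4 * K := by ring
  · -- large lags: domination, weight transfer `(n+1)³ ≤ 8 (j+1)³`, exchange of sums, multiplicity `≤ 3`
    set B := (range (S + 1)).filter (fun n => ¬ n < n₀) with hB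
    calc ∑ n ∈ B, ((n : ℝ) + 1) ^ 3 * |f n|
        ≤ ∑ n ∈ B, ∑ j ∈ range (S + 1),
            (if n ≤ j + 1 ∧ j ≤ n + 1 then 8 * (((j : ℝ) + 1) ^ 3 * g j) else 0) := by
          refine Finset.sum_le_sum fun n hn => ?_
          obtain ⟨hnS, hn0⟩ := Finset.mem_filter.1 hn
          have hnS' : n ≤ S := Nat.lt_succ_iff.1 (Finset.mem_range.1 hnS)
          have hd := hdom n (not_lt.1 hn0) hnS'
          rw [← Finset.sum_filter]
          calc ((n : ℝ) + 1) ^ 3 * |f n|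
              ≤ ((n : ℝ) + 1) ^ 3 *
                  ∑ j ∈ (range (S + 1)).filter (fun j => n ≤ j + 1 ∧ j ≤ n + 1), g j :=
                mul_le_mul_of_nonneg_left hd (by positivity)
            _ = ∑ j ∈ (range (S + 1)).filter (fun j => n ≤ j + 1 ∧ j ≤ n + 1),
                  ((n : ℝ) + 1) ^ 3 * g j := Finset.mul_sum _ _ _
            _ ≤ _ := by
                refine Finset.sum_le_sum fun j hj => ?_
                obtain ⟨-, hj1, -⟩ := Finset.mem_filter.1 hj
                have h8 : ((n : ℝ) + 1) ^ 3 ≤ 8 * ((j : ℝ) + 1) ^ 3 := by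
                  have h2 : (n : ℝ) + 1 ≤ 2 * ((j : ℝ) + 1) := by
                    have : (n : ℝ) ≤ (j : ℝ) + 1 := by exact_mod_cast hj1
                    linarith
                  calc ((n : ℝ) + 1) ^ 3 ≤ (2 * ((j : ℝ) + 1)) ^ 3 := by gcongr
                    _ = 8 * ((j : ℝ) + 1) ^ 3 := by ring
                calc ((n : ℝ) + 1) ^ 3 * g j ≤ 8 * ((j : ℝ) + 1) ^ 3 * g j :=
                      mul_le_mul_of_nonneg_right h8 (hg j)
                  _ = 8 * (((j : ℝ) + 1) ^ 3 * g j) := by ring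
      _ = ∑ j ∈ range (S + 1), ∑ n ∈ B,
            (if n ≤ j + 1 ∧ j ≤ n + 1 then 8 * (((j : ℝ) + 1) ^ 3 * g j) else 0) := Finset.sum_comm
      _ ≤ ∑ j ∈ range (S + 1), 3 * (8 * (((j : ℝ) + 1) ^ 3 * g j)) := by
          refine Finset.sum_le_sum fun j _ => ?_
          rw [Finset.sum_ite, Finset.sum_const_zero, add_zero, Finset.sum_const, nsmul_eq_mul]
          have hc : ((B.filter fun n => n ≤ j + 1 ∧ j ≤ n + 1).card : ℝ) ≤ 3 := by
            have hsub : (B.filter fun n => n ≤ j + 1 ∧ j ≤ n + 1) ⊆ Finset.Icc (j - 1) (j + 1) := by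
              intro n hn
              obtain ⟨-, h1, h2⟩ := Finset.mem_filter.1 hn
              exact Finset.mem_Icc.2 ⟨by omega, h1⟩
            have h3 := (Finset.card_le_card hsub).trans_eq (Nat.card_Icc _ _)
            exact_mod_cast (h3.trans (by omega))
          exact mul_le_mul_of_nonneg_right hc (by have := hg j; positivity)
      _ = 24 * ∑ j ∈ range (S + 1), ((j : ℝ) + 1) ^ 3 * g j := by
          rw [Finset.mul_sum]; exact Finset.sum_congr rfl fun j _ => by ring

/-- **Mirror-diagonal cubic moments ⇒ all-pairs cubic moments, at fixed coupling** (every compact `G`, every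
`β ≥ 0`). If every species `A` has `Σ_{n ≤ S} (n+1)³ |Cov_S(A∘lift, A∘Θ∘τ_{n e₀}∘lift)| ≤ M(A)` uniformly in the odd
torus, then every PAIR of species has `Σ_{n ≤ S} (n+1)³ |Cov_S(A∘lift, B∘τ_{n e₀}∘lift)| ≤ M(A, B)` uniformly in the
torus (explicitly `M(A,B) = (n₀+1)⁴ · 4‖A‖∞‖B‖∞ + 24 (M(A) + M(Aᴿ) + M(Bᴿ))`): the explicit-pair domination
`abs_cov_axial_le_mirror`, the hypothesis at `A`, `Aᴿ`, `Bᴿ` (`(Pᴿ)ᴿ = P` as functions, `cfgReflect_cfgReflect`),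
and `window_cubic_sum_le`. [folklore] -/
theorem axialMoments_of_mirrorMoments (r : LatticeRep G) {β : ℝ} (hβ : 0 ≤ β)
    (hM : ∀ A : YMSpecies G, ∃ M : ℝ, ∀ S : ℕ,
      ∑ n ∈ range (S + 1), ((n : ℝ) + 1) ^ 3 *
        |cov[fun U => A.F (torusLift (2 * S + 1) U),
            fun U => A.F (cfgReflect (configShift (-(Pi.single 0 (n : ℤ))) (torusLift (2 * S + 1) U)));
            wilsonMeasure (d := 4) (L := 2 * S + 1) r.ρ β]| ≤ M)
    (A B : YMSpecies G) :
    ∃ M : ℝ, ∀ S : ℕ, ∑ n ∈ range (S + 1), ((n : ℝ) + 1) ^ 3 *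
      |cov[fun U => A.F (torusLift (2 * S + 1) U),
          fun U => B.F (configShift (-(Pi.single 0 (n : ℤ))) (torusLift (2 * S + 1) U));
          wilsonMeasure (d := 4) (L := 2 * S + 1) r.ρ β]| ≤ M := by
  obtain ⟨n₀, hn₀⟩ := abs_cov_axial_le_mirror r hβ A B
  obtain ⟨a, ha⟩ := A.bounded
  obtain ⟨b, hb⟩ := B.bounded
  obtain ⟨M₀, hM₀⟩ := hM A
  obtain ⟨M₁, hM₁⟩ := hM (reflSpecies A)
  obtain ⟨M₂, hM₂⟩ := hM (reflSpecies B)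
  have hR : ∀ (P : YMSpecies G) (V : LGConfig 4 G), (reflSpecies P).F V = P.F (cfgReflect V) :=
    fun _ _ => rfl
  simp only [hR, cfgReflect_cfgReflect] at hM₁ hM₂
  refine ⟨((n₀ : ℝ) + 1) ^ 4 * (4 * a * b) + 24 * (M₀ + M₁ + M₂), fun S => ?_⟩
  haveI : IsProbabilityMeasure (wilsonMeasure (d := 4) (L := 2 * S + 1) r.ρ β) :=
    isProbabilityMeasure_wilsonMeasure _ r.continuous β
  have key := window_cubic_sum_le (S := S) (n₀ := n₀) (K := 4 * a * b)
    (f := fun n => cov[fun U => A.F (torusLift (2 * S + 1) U),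
        fun U => B.F (configShift (-(Pi.single 0 (n : ℤ))) (torusLift (2 * S + 1) U));
        wilsonMeasure (d := 4) (L := 2 * S + 1) r.ρ β])
    (g := fun j =>
      |cov[fun U => A.F (torusLift (2 * S + 1) U),
          fun U => A.F (cfgReflect (configShift (-(Pi.single 0 (j : ℤ))) (torusLift (2 * S + 1) U)));
          wilsonMeasure (d := 4) (L := 2 * S + 1) r.ρ β]| +
        |cov[fun U => A.F (cfgReflect (torusLift (2 * S + 1) U)),
          fun U => A.F (configShift (-(Pi.single 0 (j : ℤ))) (torusLift (2 * S + 1) U));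
          wilsonMeasure (d := 4) (L := 2 * S + 1) r.ρ β]| +
        |cov[fun U => B.F (cfgReflect (torusLift (2 * S + 1) U)),
          fun U => B.F (configShift (-(Pi.single 0 (j : ℤ))) (torusLift (2 * S + 1) U));
          wilsonMeasure (d := 4) (L := 2 * S + 1) r.ρ β]|)
    (fun n => Negative.abs_covariance_le_of_abs_le (fun U => ha _) (fun U => hb _))
    (fun j => by positivity) (fun n h1 h2 => hn₀ S n h1 h2)
  refine key.trans (add_le_add le_rfl (mul_le_mul_of_nonneg_left ?_ (by norm_num : (0 : ℝ) ≤ 24)))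
  have hsplit : ∀ (u v w : ℕ → ℝ), ∑ j ∈ range (S + 1), ((j : ℝ) + 1) ^ 3 * (u j + v j + w j) =
      ∑ j ∈ range (S + 1), ((j : ℝ) + 1) ^ 3 * u j + ∑ j ∈ range (S + 1), ((j : ℝ) + 1) ^ 3 * v j +
        ∑ j ∈ range (S + 1), ((j : ℝ) + 1) ^ 3 * w j := fun u v w => by
    rw [← Finset.sum_add_distrib, ← Finset.sum_add_distrib]
    exact Finset.sum_congr rfl fun j _ => by ring
  rw [hsplit]
  exact add_le_add (add_le_add (hM₀ S) (hM₁ S)) (hM₂ S)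

/-- The converse direction (trivial): all-pairs cubic time-axis moments give the mirror-diagonal ones (`B := Aᴿ`),
so at every coupling the two statements are EQUIVALENT. [folklore] -/
theorem mirrorMoments_of_axialMoments (r : LatticeRep G) (β : ℝ)
    (h : ∀ A B : YMSpecies G, ∃ M : ℝ, ∀ S : ℕ, ∑ n ∈ range (S + 1), ((n : ℝ) + 1) ^ 3 *
      |cov[fun U => A.F (torusLift (2 * S + 1) U),
          fun U => B.F (configShift (-(Pi.single 0 (n : ℤ))) (torusLift (2 * S + 1) U));
          wilsonMeasure (d := 4) (L := 2 * S + 1) r.ρ β]| ≤ M)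
    (A : YMSpecies G) :
    ∃ M : ℝ, ∀ S : ℕ, ∑ n ∈ range (S + 1), ((n : ℝ) + 1) ^ 3 *
      |cov[fun U => A.F (torusLift (2 * S + 1) U),
          fun U => A.F (cfgReflect (configShift (-(Pi.single 0 (n : ℤ))) (torusLift (2 * S + 1) U)));
          wilsonMeasure (d := 4) (L := 2 * S + 1) r.ρ β]| ≤ M :=
  h A (reflSpecies A)

end MirrorFunnel

open MirrorFunnel in
/-- **Mirror-diagonal cubic moments at weak coupling ⇒ crux.** If for every compact simple `G` and faithful unitary
`r` there is `β₀` such that for all `β ≥ β₀` every gauge-invariant local observable `A` has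
`Σ_{n ≤ S} (n+1)³ |Cov_S(A∘lift, A∘Θ∘τ_{n e₀}∘lift)|` bounded uniformly in the odd torus (`Θ = cfgReflect`), then
`FiniteSusceptibilityWeakCoupling` (with `β₀ ↦ max β₀ 0`; through `axialMoments_of_mirrorMoments` and the landed
`finiteSusceptibilityWeakCoupling_of_axialCubicMoment`). [folklore] -/
theorem finiteSusceptibilityWeakCoupling_of_mirrorCubicMoment
    (h : ∀ (G : Type) [Group G] [TopologicalSpace G] [IsTopologicalGroup G] [CompactSpace G]
      [MeasurableSpace G] [BorelSpace G], IsCompactSimpleLieGroup G → ∀ (r : LatticeRep G),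
      ∃ β₀ : ℝ, ∀ β : ℝ, β₀ ≤ β → ∀ A : YMSpecies G, ∃ M : ℝ, ∀ S : ℕ,
        ∑ n ∈ Finset.range (S + 1), ((n : ℝ) + 1) ^ 3 *
          |cov[fun U => A.F (torusLift (2 * S + 1) U),
              fun U => A.F (cfgReflect (configShift (-(Pi.single 0 (n : ℤ))) (torusLift (2 * S + 1) U)));
              wilsonMeasure (d := 4) (L := 2 * S + 1) r.ρ β]| ≤ M) :
    Summit.QuantumFields.YangMills.Theses.FradkinShenkerFlow.FiniteSusceptibilityWeakCoupling := by
  refine finiteSusceptibilityWeakCoupling_of_axialCubicMoment fun G _ _ _ _ _ _ hG r => ?_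
  obtain ⟨β₀, hβ₀⟩ := h G hG r
  refine ⟨max β₀ 0, fun β hβ A B => ?_⟩
  exact axialMoments_of_mirrorMoments r ((le_max_right _ _).trans hβ)
    (hβ₀ β ((le_max_left _ _).trans hβ)) A B

/-- **Registered sub-goal `stub_cruxOfMirrorCubicMoment`** of item stmt-QuantumFields-9442 (signature verbatim, fully
qualified): the mirror-diagonal time-axis cubic moment bound at weak coupling — the line's open stub
`stub_mirrorCubicMoment`, here the antecedent — implies the crux. [folklore] -/
theorem stub_cruxOfMirrorCubicMoment : (∀ (G : Type) [Group G] [TopologicalSpace G] [IsTopologicalGroup G] [CompactSpace G] [MeasurableSpace G] [BorelSpace G], Literature.MathematicalPhysics.QuantumFieldTheory.IsCompactSimpleLieGroup G → ∀ (r : Literature.MathematicalPhysics.QuantumFieldTheory.LatticeRep G), ∃ β₀ : ℝ, ∀ β : ℝ, β₀ ≤ β → ∀ A : Literature.MathematicalPhysics.QuantumFieldTheory.YMSpecies G, ∃ M : ℝ, ∀ S : ℕ, ∑ n ∈ Finset.range (S + 1), ((n : ℝ) + 1) ^ 3 * |ProbabilityTheory.covariance (fun U => A.F (Literature.MathematicalPhysics.QuantumLattice.torusLift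 (2 * S + 1) U)) (fun U => A.F (Literature.MathematicalPhysics.QuantumFieldTheory.cfgReflect (Literature.MathematicalPhysics.QuantumLattice.configShift (-(Pi.single 0 (n : ℤ))) (Literature.MathematicalPhysics.QuantumLattice.torusLift (2 * S + 1) U)))) (Literature.MathematicalPhysics.QuantumFieldTheory.wilsonMeasure (d := 4) (L := 2 * S + 1) r.ρ β)| ≤ M) → Summit.QuantumFields.YangMills.Theses.FradkinShenkerFlow.FiniteSusceptibilityWeakCoupling :=
  finiteSusceptibilityWeakCoupling_of_mirrorCubicMoment


/-- **The same attach point in the tree's standard correlator vocabulary** (`latticeConnectedCorr`, the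
connected time-correlation used by every lattice-gap leg of the sub-problem): if for every compact simple `G` and
faithful unitary `r` there is `β₀` such that for all `β ≥ β₀` every gauge-invariant local observable `A` satisfies
`Σ_{n ≤ S} (n+1)³ |⟨A · τ_{n e₀}(A∘Θ)⟩_{β,2S+1} − ⟨A⟩⟨A∘Θ⟩| ≤ M(A, β)` for every `S` (`Θ = cfgReflect`), then
`FiniteSusceptibilityWeakCoupling`. (`SiblingFunnel.covariance_eq_latticeConnectedCorr` at the mirror species
`Aᴿ = reflSpecies A`, whose observable is `A ∘ Θ` by definition.) [folklore] -/
theorem finiteSusceptibilityWeakCoupling_of_mirrorCorrMoment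
    (h : ∀ (G : Type) [Group G] [TopologicalSpace G] [IsTopologicalGroup G] [CompactSpace G]
      [MeasurableSpace G] [BorelSpace G], IsCompactSimpleLieGroup G → ∀ (r : LatticeRep G),
      ∃ β₀ : ℝ, ∀ β : ℝ, β₀ ≤ β → ∀ A : YMSpecies G, ∃ M : ℝ, ∀ S : ℕ,
        ∑ n ∈ Finset.range (S + 1), ((n : ℝ) + 1) ^ 3 *
          |latticeConnectedCorr r.ρ β (2 * S + 1) A.F (fun V => A.F (cfgReflect V)) n| ≤ M) :
    Summit.QuantumFields.YangMills.Theses.FradkinShenkerFlow.FiniteSusceptibilityWeakCoupling := by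
  refine finiteSusceptibilityWeakCoupling_of_mirrorCubicMoment fun G _ _ _ _ _ _ hG r => ?_
  obtain ⟨β₀, hβ₀⟩ := h G hG r
  refine ⟨β₀, fun β hβ A => ?_⟩
  obtain ⟨M, hM⟩ := hβ₀ β hβ A
  refine ⟨M, fun S => ?_⟩
  have key : ∀ n : ℕ, cov[fun U => A.F (torusLift (2 * S + 1) U),
      fun U => A.F (cfgReflect (configShift (-(Pi.single 0 (n : ℤ))) (torusLift (2 * S + 1) U)));
      wilsonMeasure (d := 4) (L := 2 * S + 1) r.ρ β] =
      latticeConnectedCorr r.ρ β (2 * S + 1) A.F (fun V => A.F (cfgReflect V)) n := fun n =>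
    SiblingFunnel.covariance_eq_latticeConnectedCorr r β A (MirrorDominationAxis0.reflSpecies A) S n
  simp only [key]
  exact hM S

/-- **Registered sub-goal `stub_cruxOfMirrorCorrMoment`** of item stmt-QuantumFields-9442 (signature verbatim, fully
qualified; the promotable form of the line's open stub, in `latticeConnectedCorr` vocabulary): cubic time-axis
moments of every gauge-invariant local observable against its own mirror image, bounded uniformly in the odd torus
at every `β ≥ β₀(G, r)`, imply the crux. [folklore] -/
theorem stub_cruxOfMirrorCorrMoment : (∀ (G : Type) [Group G] [TopologicalSpace G] [IsTopologicalGroup G] [CompactSpace G] [MeasurableSpace G] [BorelSpace G], Literature.MathematicalPhysics.QuantumFieldTheory.IsCompactSimpleLieGroup G → ∀ (r : Literature.MathematicalPhysics.QuantumFieldTheory.LatticeRep G), ∃ β₀ : ℝ, ∀ β : ℝ, β₀ ≤ β → ∀ A : Literature.MathematicalPhysics.QuantumFieldTheory.YMSpecies G, ∃ M : ℝ, ∀ S : ℕ, ∑ n ∈ Finset.range (S + 1), ((n : ℝ) + 1) ^ 3 * |Literature.MathematicalPhysics.QuantumFieldTheory.latticeConnectedCorr r.ρ β (2 * S + 1)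 A.F (fun V => A.F (Literature.MathematicalPhysics.QuantumFieldTheory.cfgReflect V)) n| ≤ M) → Summit.QuantumFields.YangMills.Theses.FradkinShenkerFlow.FiniteSusceptibilityWeakCoupling :=
  finiteSusceptibilityWeakCoupling_of_mirrorCorrMoment

end Summit.QuantumFields.YangMills.Theorems.FiniteSusceptibilityWeakCoupling
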